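/-
Copyright (c) 2026 the pub-hodgecm-mathlib formalisation cell (harness21).  Prover seat hodgecm-mathlib-K2E3-p04 (g2), Track B ∕ K2-LIT
(build stream 29), h413 = `stmt-HodgeConjecture-24833`, line `K2_E3_EllipticInputs`, unit U4 «Keys» — road I («Keys' own road»: the rank-one intertwining
integral), brick I-3c «THE SHELL EXPANSION OF HARISH-CHANDRA'S `c`-FUNCTION».  2026-09-04.
-/
import Summits.HodgeConjecture.HodgeConjecture.Theorems.K2E3SphericalCellFunction             -- ★ p855622 (this base, g0): the exact cell function of a `K_v`-fixed vector (`= f(1)` on the unit ball, `= χ₁(σb)⁻¹ χ₂(−1) ‖b‖⁻¹ f(1)` outside)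
import Summits.HodgeConjecture.HodgeConjecture.Theorems.K2E3IntertwiningIntegralSphericalLine   -- ★ p855557 (this base, g0): `J f_K = (∫_N f_K(w₀ n) dμ) • f'_K`; brings ★ p855375 `integrable_cellFun`
import Summits.HodgeConjecture.HodgeConjecture.Theorems.K2E3NonUnitaryCharacterDichotomy       -- ★ (K2E3-p05): `exists_uniformizer_zpow_mul` (`x = ϖⁿ u`, `u ∈ 𝒪_vˣ`); brings ★ TorusRay (`valued_coe_zpow_apply`), ★ TorusCompactPart (`mem_unitsIntegers_iff`), ★ DICT
import HarnessLib

/-!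
# h413 ∕ Track B «K2-LIT», unit U4 «Keys», road I brick I-3c: THE SHELL EXPANSION OF HARISH-CHANDRA'S `c`-FUNCTION on `U(Φ₃)(L⁺_v)` —
# for an UNRAMIFIED `χ₁` and a `K_v`-fixed `f ∈ i_G(χ₁, χ₂)`:  `∫_N f(w₀ n) dμ(n) = μ(B₁)·f(1) + χ₂(−1)·Σ_{k ≥ 1} (χ₁(ϖ)‖ϖ‖)ᵏ μ(S_k)·f(1)`,
# `B₁ = {‖u₀₂‖ ≤ 1}`, `S_k = {‖u₀₂‖ = ‖ϖ‖⁻ᵏ}`  [Casselman1995 §6.4; Rogawski1990 §4.5 p. 45; Keys1984 §4]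

Cell `pub/hodgecm-mathlib`, crux H413 = `stmt-HodgeConjecture-24833` (lane `--supports … --as helper`), route HCCMUnconditional; dealer K2E3-plan (g1) («Road I files stay
`--supports 24833 --as helper`», 2026-09-03T23:02Z); file 2 of MEMO `K2/K2E3-p04/g0/MEMO-ROAD-I-intertwining-integral.K2E3-p04-g0.md` §3.  THEOREMS ONLY (0 def ∕ 0 instance ∕
0 notation ∕ 0 sorry); ★-only imports.  The consumer is U4-f `sig_K2E3KeysThmTwoContracting` (K2E4-p11 (g2)) through the closed form of `c_w(χ)` on the unramified line:
★ I-2a `exists_intertwiningIntegral_sphericalVector_eq_smul` says `J(w, χ) f_K = c_w(χ) • f'_K` with `c_w(χ) = ∫_N f_K(w₀ n) dμ`; this file turns that integral into SHELL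
ARITHMETIC — a constant term `μ(B₁)` plus a power series in `z‖ϖ‖ = χ₁(ϖ)∕q_w` whose coefficients are the shell volumes `μ(S_k)` (which ★ `K2E3HeightBallVolumeScaling` makes
`2`-periodic up to the factor `q_w²`, so that only `μ(B₁) : μ(S₁) : μ(S₂)` remain to be computed — the next brick).

THE MATHEMATICS ([Casselman1995, §6.4 p. 63]: the integral is computed shell by shell, `|x| = q^k`; [Rogawski1990, §4.5 p. 45]; [Keys1984, §4]).  `v` non-split, `w ∣ v` the
place, `R = Π_{w∣v} L_w` (one local field), `σ = c ⊗ 1`, `ϖ ∈ Rˣ` a uniformiser unit (★ `exists_uniformizer_units`: `|ϖ_w|_w = exp(−1)`), `‖·‖` the module (★ `unitModulusChar`;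
`‖ϖ‖ = q_w⁻¹ < 1`), `N = N(L⁺_v)`, height `m(u) = Π_{w′} |(u₀₂)_{w′}|_{w′}` (★ norm balls of `F0P3cStCharTSKeys3AnnulusDock`), `χ₁ : Rˣ → ℂˣ` UNRAMIFIED (`χ₁ = 1` on
`𝒪_vˣ = (Π_w 𝒪_w)ˣ`, the compact part of ★ `F0P3cStCharTSTorusCompactPart`), `χ₂ : E¹ → ℂˣ` arbitrary, `f` a `K_v`-fixed vector of ★ `cmPrincipalSeries L 3 v (χ₁, χ₂)`, `w₀` of matrix `Φ₃`.
* §1 `apply_eq_apply_uniformizer_zpow` — `|x_w|_w = exp(−n)` ⇒ `χ₁(x) = χ₁(ϖ)ⁿ` (`x ϖ⁻ⁿ ∈ 𝒪_vˣ`; any finite `v`); `apply_unitsMap_conjLocal` — `χ₁(σ x) = χ₁(x)` (`σ` is an isometry at a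
  non-split place, ★ `valued_conjLocal_apply_of_smul_eq`).
* §2 `unitModulusChar_uniformizer_lt_one` (`‖ϖ‖ < 1`); `exists_height_eq_zpow` (`u₀₂ ∈ Rˣ ⇒ |u₀₂|_w = exp(−m)`, `m(u) = ‖ϖ‖^m`, ★ `exists_uniformizer_zpow_mul`);
  **`height_le_one_or_eq_inv_pow`** — THE SHELL PARTITION: every `u ∈ N` has `m(u) ≤ 1` or `m(u) = (‖ϖ‖⁻¹)^{n+1}` for some `n : ℕ` (the values of `m` lie in `{0} ∪ q_w^ℤ`).
* §3 **`toFun_weylElt_mul_eq_on_shell`** — on `m(u) = (‖ϖ‖⁻¹)^{n+1}`: `f(w₀ u) = χ₁(ϖ)^{n+1} · χ₂(−1) · ‖ϖ‖^{n+1} · f(1)` (★ `toFun_weylElt_mul_eq_of_one_lt_height` gives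
  `χ₁(σ b)⁻¹ χ₂(−1) ‖b‖⁻¹ f(1)`, `b = u₀₂ = ϖ^{−(n+1)}·unit`, and §1 evaluates `χ₁(σ b) = χ₁(ϖ)^{−(n+1)}`).
* §4 `hasSum_shell_integrals` — the shells are measurable, disjoint, with union `{1 < m}`: `Σ_n μ(S_{n+1})·const_n·f(1)` has sum `∫_{1<m} f(w₀ u) dμ`;
  **`integral_cellFun_eq_shellExpansion`** — for ANY measure `μ` and any `μ`-integrable cell function: `∫_N f(w₀ u) dμ = μ(B₁)·f(1) + Σ'_n μ(S_{n+1})·(χ₁(ϖ)^{n+1} χ₂(−1) ‖ϖ‖^{n+1})·f(1)`;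
  `…_of_modulus` — integrability DISCHARGED by ★ `integrable_cellFun` (`|χ₁| = ‖·‖^s`, `s > 0`, `μ` Haar).
* §5 **`exists_intertwiningIntegral_sphericalVector_eq_shellExpansion_smul`** — docked on ★ I-2a: the intertwining integral `J ≠ 0` of ★ RUNG 3 satisfies
  `J f_K = (μ(B₁) f_K(1) + Σ'_n μ(S_{n+1}) (χ₁(ϖ)‖ϖ‖)^{n+1} χ₂(−1) f_K(1)) • f'_K` — HARISH-CHANDRA's `c_w(χ)` AS A SHELL SERIES.
NOT here: the volumes `μ(B₁) : μ(S₁) : μ(S₂)` by ramification type (brick I-3d) and the rational function of `z = χ₁(ϖ)` they give with the `q_w²`-periodicity ★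
`K2E3HeightBallVolumeScaling` (brick I-3e, to be checked against Macdonald's formula [Casselman1995, §6.4; Rogawski1990, §4.5]).

HONEST LABEL.  HC_CM is proved only modulo the 7 printed citations (2 remaining named inputs: hLiu418 = `stmt-HodgeConjecture-24832`, h413 = `stmt-HodgeConjecture-24833`) until
rung 0 closes; count-neutral infrastructure of road I (no socket is paid by this file).

## References
* [Casselman1995] W. Casselman, *Introduction to the theory of admissible representations of `p`-adic reductive groups* (1995), §6.4 pp. 62–64 (the `c`-function `c_w(χ)`,
  «`T_w φ_K = c_w(χ) φ_{K, wχ}`», computed shell by shell), Prop. 1.3.3.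
* [Rogawski1990] J. D. Rogawski, *Automorphic Representations of Unitary Groups in Three Variables* (1990), §1.10 p. 9, §4.5 p. 45, §12.2 p. 173.
* [Keys1984] D. Keys, *Principal series representations of special unitary groups over local fields*, Compositio Math. 51 (1984), §3–§4.
* [WeilBNT1967] A. Weil, *Basic Number Theory* (1967), Ch. I §4 (`K^× = ϖ^ℤ × 𝒪^×`, the module `‖ϖ‖ = q⁻¹`), Ch. II §5.
* [TateThesis1967] J. Tate, *Fourier analysis in number fields and Hecke's zeta-functions*, in Cassels–Fröhlich (1967), §2.4 (integration shell by shell over `ϖ^k 𝒪^×`).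
-/

set_option autoImplicit false
-- the mandated namespace repeats the single-problem summit's segment (`HodgeConjecture.HodgeConjecture`)
set_option linter.dupNamespace false

noncomputable section

open NumberField IsDedekindDomain MeasureTheory
open scoped Matrix NNReal ENNReal

open Literature.NumberTheory Literature.NumberTheory.Automorphic Literature.NumberTheory.Automorphic.UnitaryGroup
open Literature.NumberTheory.GaloisRepresentations Literature.NumberTheory.GaloisRepresentations.IsNonarchimedeanLocalField

namespace Summit.HodgeConjecture.HodgeConjecture.Cruxes.H413.K2E3SphericalCFunctionShellExpansion

variable (L : Type) [Field L] [NumberField L] [IsCMField L] (v : HeightOneSpectrum (𝓞 ↥(maximalRealSubfield L)))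

/-! ## §1 Unramified characters of `Rˣ`: `χ₁(x) = χ₁(ϖ)^{ord x}` and `χ₁(σ x) = χ₁(x)` -/

omit [IsCMField L] in
/-- **`χ₁(x) = χ₁(ϖ)ⁿ` when `|x_w|_w = exp(−n)` at every `w ∣ v`**, for `χ₁` UNRAMIFIED (`χ₁ = 1` on `𝒪_vˣ = (Π_{w∣v} 𝒪_w)ˣ`) and `ϖ` a uniformiser unit (`|ϖ_w|_w = exp(−1)`):
`x · ϖ⁻ⁿ` has valuation `1` everywhere, i.e. lies in `𝒪_vˣ` (★ `mem_unitsIntegers_iff`).  Any finite `v`. [cite: WeilBNT1967, Ch. I §4] [cite: Casselman1995, §6.4 p. 63] -/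
theorem apply_eq_apply_uniformizer_zpow (χ₁ : (LocalRing L v)ˣ →* ℂˣ)
    (hunr : ∀ u ∈ (Submonoid.pi Set.univ (fun w : PlacesOver L v => (w.1.adicCompletionIntegers L).toSubring.toSubmonoid)).units, χ₁ u = 1)
    (ϖ : (LocalRing L v)ˣ) (hϖ : ∀ w : PlacesOver L v, Valued.v ((ϖ : LocalRing L v) w) = WithZero.exp (-1 : ℤ))
    (x : (LocalRing L v)ˣ) (n : ℤ) (hx : ∀ w : PlacesOver L v, Valued.v ((x : LocalRing L v) w) = WithZero.exp (-n)) :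
    χ₁ x = χ₁ ϖ ^ n := by
  have hmem : x * (ϖ ^ n)⁻¹ ∈ (Submonoid.pi Set.univ (fun w : PlacesOver L v => (w.1.adicCompletionIntegers L).toSubring.toSubmonoid)).units := by
    rw [F0P3cStCharTSTorusCompactPart.mem_unitsIntegers_iff]
    intro w
    rw [← zpow_neg, Units.val_mul, Pi.mul_apply, map_mul, F0P3cStCharTSTorusRay.valued_coe_zpow_apply, hϖ, hx w, ← WithZero.exp_zsmul, smul_eq_mul,
      mul_neg, mul_one, neg_neg, ← WithZero.exp_add, neg_add_cancel, WithZero.exp_zero]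
  have h := hunr _ hmem
  rwa [map_mul, map_inv, map_zpow, mul_inv_eq_one] at h

/-- **`χ₁(σ x) = χ₁(x)` for UNRAMIFIED `χ₁` at a NON-SPLIT `v`**: `σ x · x⁻¹ ∈ 𝒪_vˣ` because `σ = c ⊗ 1` is an isometry at the one place above `v` (★ `valued_conjLocal_apply_of_smul_eq`).
(So on the shells the factor `χ₁(σ b)⁻¹` of the far-out cell function is `χ₁(b)⁻¹`.) [cite: Rogawski1990, §12.2 p. 173] [cite: WeilBNT1967, Ch. I §4] -/
theorem apply_unitsMap_conjLocal (hns : ∀ w : PlacesOver L v, IsCMField.complexConj L • w.1 = w.1) (χ₁ : (LocalRing L v)ˣ →* ℂˣ)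
    (hunr : ∀ u ∈ (Submonoid.pi Set.univ (fun w : PlacesOver L v => (w.1.adicCompletionIntegers L).toSubring.toSubmonoid)).units, χ₁ u = 1)
    (x : (LocalRing L v)ˣ) :
    χ₁ (Units.map (conjLocal L (IsCMField.complexConj L) v : LocalRing L v →* LocalRing L v) x) = χ₁ x := by
  have hmem : Units.map (conjLocal L (IsCMField.complexConj L) v : LocalRing L v →* LocalRing L v) x * x⁻¹ ∈
      (Submonoid.pi Set.univ (fun w : PlacesOver L v => (w.1.adicCompletionIntegers L).toSubring.toSubmonoid)).units := by
    rw [F0P3cStCharTSTorusCompactPart.mem_unitsIntegers_iff]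
    intro w
    rw [Units.val_mul, Pi.mul_apply, map_mul, Units.coe_map, MonoidHom.coe_coe, valued_conjLocal_apply_of_smul_eq L v w (hns w) (x : LocalRing L v),
      ← map_mul, ← Pi.mul_apply, ← Units.val_mul, mul_inv_cancel, Units.val_one, Pi.one_apply, map_one]
  have h := hunr _ hmem
  rwa [map_mul, map_inv, mul_inv_eq_one] at h

/-! ## §2 Heights on `N(L⁺_v)`: the values of `m(u) = Π_w |(u₀₂)_w|_w` lie in `{0} ∪ ‖ϖ‖^ℤ` -/

/-- **`‖ϖ‖ < 1`** for a uniformiser unit at a non-split `v` (★ DICT `unitModulusChar_lt_one_iff`: `‖ϖ‖ < 1 ↔ |ϖ_w|_w < 1`, and `exp(−1) < exp 0`). [cite: WeilBNT1967, Ch. I §4] -/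
theorem unitModulusChar_uniformizer_lt_one (hns : ∀ w : PlacesOver L v, IsCMField.complexConj L • w.1 = w.1)
    (ϖ : (LocalRing L v)ˣ) (hϖ : ∀ w : PlacesOver L v, Valued.v ((ϖ : LocalRing L v) w) = WithZero.exp (-1 : ℤ)) :
    unitModulusChar (LocalRing L v) ϖ < 1 := by
  obtain ⟨w⟩ : Nonempty (PlacesOver L v) := inferInstance
  exact (F0P3cStCharTSLocalRingNormDictionary.unitModulusChar_lt_one_iff L v w (hns w) ϖ).2
    (by rw [hϖ w, ← WithZero.exp_zero]; exact WithZero.exp_lt_exp.2 (by norm_num))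

set_option synthInstance.maxHeartbeats 400000 in
set_option maxHeartbeats 3200000 in
-- the matrix-group carrier of `N(L⁺_v)` (class of ★ `K2E3SphericalCellFunction.unipotent_mem_cmLocalIntegralLevel_of_height_le_one`)
/-- **The height of `u ∈ N` with `u₀₂ ∈ Rˣ` is a power of `‖ϖ‖`**: `u₀₂ = ϖ^m · u′` with `u′ ∈ 𝒪_vˣ` (★ `exists_uniformizer_zpow_mul`), so `|(u₀₂)_w|_w = exp(−m)` and
`m(u) = ‖u₀₂‖ = ‖ϖ‖^m` (`‖u′‖ = 1`, ★ `unitModulusChar_eq_one_of_forall_v_eq_one`; `m(u) = ‖u₀₂‖` is ★ `unitModulusChar_localRing_eq_prod`). `v` non-split. [cite: WeilBNT1967, Ch. I §4] [cite: Rogawski1990, §1.10 p. 9] -/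
theorem exists_height_eq_zpow (hns : ∀ w : PlacesOver L v, IsCMField.complexConj L • w.1 = w.1)
    (ϖ : (LocalRing L v)ˣ) (hϖ : ∀ w : PlacesOver L v, Valued.v ((ϖ : LocalRing L v) w) = WithZero.exp (-1 : ℤ))
    (u : ↥(cmBorelTriple L 3 v).N)
    (hb : IsUnit (((((u : ↥(unitaryGroupOfForm (conjLocal L (IsCMField.complexConj L) v) (cmLocalForm L 3 v)))) : GL (Fin 3) (LocalRing L v)) : Matrix (Fin 3) (Fin 3) (LocalRing L v)) 0 2)) :
    ∃ m : ℤ, (∀ w : PlacesOver L v, Valued.v ((((((u : ↥(unitaryGroupOfForm (conjLocal L (IsCMField.complexConj L) v) (cmLocalForm L 3 v)))) : GL (Fin 3) (LocalRing L v)) : Matrix (Fin 3) (Fin 3) (LocalRing L v)) 0 2) w) = WithZero.exp (-m)) ∧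
      (∏ w' : PlacesOver L v, normAbs (w'.1.adicCompletion L) ((((((u : ↥(unitaryGroupOfForm (conjLocal L (IsCMField.complexConj L) v) (cmLocalForm L 3 v)))) : GL (Fin 3) (LocalRing L v)) : Matrix (Fin 3) (Fin 3) (LocalRing L v)) 0 2) w')) =
        unitModulusChar (LocalRing L v) ϖ ^ m := by
  obtain ⟨m, u₀, hu₀, hbu, hvb⟩ := K2E3NonUnitaryCharacterDichotomy.exists_uniformizer_zpow_mul L v hns ϖ hϖ hb.unit
  have hnorm : unitModulusChar (LocalRing L v) hb.unit =
      ∏ w' : PlacesOver L v, normAbs (w'.1.adicCompletion L) ((((((u : ↥(unitaryGroupOfForm (conjLocal L (IsCMField.complexConj L) v) (cmLocalForm L 3 v)))) : GL (Fin 3) (LocalRing L v)) : Matrix (Fin 3) (Fin 3) (LocalRing L v)) 0 2) w') := by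
    rw [unitModulusChar_localRing_eq_prod, hb.unit_spec]
  refine ⟨m, fun w => ?_, ?_⟩
  · have h := hvb w
    rwa [hb.unit_spec] at h
  · rw [← hnorm, hbu, map_mul, map_zpow, unitModulusChar_eq_one_of_forall_v_eq_one L v u₀ ((F0P3cStCharTSTorusCompactPart.mem_unitsIntegers_iff L v u₀).1 hu₀), mul_one]

set_option synthInstance.maxHeartbeats 400000 in
set_option maxHeartbeats 3200000 in
-- the matrix-group carrier of `N(L⁺_v)` (class of ★ `K2E3SphericalCellFunction.unipotent_mem_cmLocalIntegralLevel_of_height_le_one`)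
/-- **THE SHELL PARTITION OF `N(L⁺_v)`** (`v` non-split, `ϖ` a uniformiser unit): every `u ∈ N` has height `m(u) ≤ 1`, or `m(u) = (‖ϖ‖⁻¹)^{n+1} = q_w^{n+1}` for some `n : ℕ`
(`u₀₂ = 0`, or `u₀₂ = ϖ^m·unit` with `m ≥ 0`, or with `m = −(n+1) < 0`). [cite: Casselman1995, §6.4 p. 63] [cite: TateThesis1967, §2.4] [cite: WeilBNT1967, Ch. I §4] -/
theorem height_le_one_or_eq_inv_pow (hns : ∀ w : PlacesOver L v, IsCMField.complexConj L • w.1 = w.1)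
    (ϖ : (LocalRing L v)ˣ) (hϖ : ∀ w : PlacesOver L v, Valued.v ((ϖ : LocalRing L v) w) = WithZero.exp (-1 : ℤ))
    (u : ↥(cmBorelTriple L 3 v).N) :
    (((∏ w' : PlacesOver L v, normAbs (w'.1.adicCompletion L) ((((((u : ↥(unitaryGroupOfForm (conjLocal L (IsCMField.complexConj L) v) (cmLocalForm L 3 v)))) : GL (Fin 3) (LocalRing L v)) : Matrix (Fin 3) (Fin 3) (LocalRing L v)) 0 2) w')) : ℝ≥0) : ℝ) ≤ 1 ∨
      ∃ n : ℕ, (((∏ w' : PlacesOver L v, normAbs (w'.1.adicCompletion L) ((((((u : ↥(unitaryGroupOfForm (conjLocal L (IsCMField.complexConj L) v) (cmLocalForm L 3 v)))) : GL (Fin 3) (LocalRing L v)) : Matrix (Fin 3) (Fin 3) (LocalRing L v)) 0 2) w')) : ℝ≥0) : ℝ) =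
        (((unitModulusChar (LocalRing L v) ϖ : ℝ≥0) : ℝ)⁻¹) ^ (n + 1) := by
  obtain ⟨w⟩ : Nonempty (PlacesOver L v) := inferInstance
  have hw := hns w
  by_cases hb0 : (((((u : ↥(unitaryGroupOfForm (conjLocal L (IsCMField.complexConj L) v) (cmLocalForm L 3 v)))) : GL (Fin 3) (LocalRing L v)) : Matrix (Fin 3) (Fin 3) (LocalRing L v)) 0 2) = 0
  · left
    rw [(F0P3cStCharTSLocalRingNormDictionary.prod_normAbs_eq_zero_iff L v w hw _).2 hb0, NNReal.coe_zero]
    exact zero_le_one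
  · have hb : IsUnit (((((u : ↥(unitaryGroupOfForm (conjLocal L (IsCMField.complexConj L) v) (cmLocalForm L 3 v)))) : GL (Fin 3) (LocalRing L v)) : Matrix (Fin 3) (Fin 3) (LocalRing L v)) 0 2) :=
      (F0P3cStCharTSLocalRingNormDictionary.isUnit_iff_ne_zero_localRing L v w hw _).2 hb0
    obtain ⟨m, -, hm⟩ := exists_height_eq_zpow L v hns ϖ hϖ u hb
    have ha1 : ((unitModulusChar (LocalRing L v) ϖ : ℝ≥0) : ℝ) ≤ 1 := by exact_mod_cast (unitModulusChar_uniformizer_lt_one L v hns ϖ hϖ).le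
    have ha0 : 0 ≤ ((unitModulusChar (LocalRing L v) ϖ : ℝ≥0) : ℝ) := NNReal.coe_nonneg _
    rw [hm, NNReal.coe_zpow]
    rcases le_or_gt 0 m with h0m | hm0
    · left
      obtain ⟨k, rfl⟩ := Int.eq_ofNat_of_zero_le h0m
      rw [zpow_natCast]
      exact pow_le_one₀ ha0 ha1
    · right
      obtain ⟨k, hk⟩ := Int.exists_eq_neg_ofNat hm0.le
      have hk0 : k ≠ 0 := by
        rintro rfl
        rw [hk, Nat.cast_zero, neg_zero] at hm0
        exact lt_irrefl _ hm0
      obtain ⟨n, rfl⟩ := Nat.exists_eq_succ_of_ne_zero hk0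
      refine ⟨n, ?_⟩
      rw [hk, zpow_neg, zpow_natCast, inv_pow]

/-! ## §3 The cell function of a `K_v`-fixed vector on the shell `m(u) = q_w^{n+1}` -/

set_option synthInstance.maxHeartbeats 400000 in
set_option maxHeartbeats 6000000 in
-- statement∕proof over the `SmoothInd` carrier of ★ `cmPrincipalSeries` (class of ★ `K2E3SphericalCellFunction.toFun_weylElt_mul_eq_of_one_lt_height`)
/-- **THE CELL FUNCTION ON A SHELL.**  `v` non-split, `χ₁` UNRAMIFIED, `ϖ` a uniformiser unit, `w₀` of matrix `Φ₃`, `f` a `K_v`-fixed vector of the carrier of ★ `cmPrincipalSeries L 3 v (χ₁, χ₂)`,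
`u ∈ N` on the shell `m(u) = (‖ϖ‖⁻¹)^{n+1}`.  Then **`f(w₀ u) = (χ₁(ϖ)^{n+1} · χ₂(−1) · ‖ϖ‖^{n+1}) · f(1)`**: ★ `toFun_weylElt_mul_eq_of_one_lt_height` gives `χ₁(σ b)⁻¹ χ₂(−1) ‖b‖⁻¹ f(1)`
for the unit `b = u₀₂`; `‖b‖ = m(u) = ‖ϖ‖^{−(n+1)}` forces `|b_w|_w = exp(n+1)` (§2, injectivity of `k ↦ ‖ϖ‖^k`), so `χ₁(σ b) = χ₁(b) = χ₁(ϖ)^{−(n+1)}` (§1).  The integrand of `c_w(χ)` on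
the `k`-th shell is the constant `(χ₁(ϖ)∕q_w)^k χ₂(−1) f(1)`, `k = n + 1`. [cite: Casselman1995, §6.4 p. 63] [cite: Rogawski1990, §4.5 p. 45] [cite: Keys1984, §4] -/
theorem toFun_weylElt_mul_eq_on_shell (hns : ∀ w : PlacesOver L v, IsCMField.complexConj L • w.1 = w.1)
    (χ₁ : (LocalRing L v)ˣ →* ℂˣ) (χ₂ : ↥(normOneUnits (conjLocal L (IsCMField.complexConj L) v)) →* ℂˣ)
    (hunr : ∀ u ∈ (Submonoid.pi Set.univ (fun w : PlacesOver L v => (w.1.adicCompletionIntegers L).toSubring.toSubmonoid)).units, χ₁ u = 1)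
    (ϖ : (LocalRing L v)ˣ) (hϖ : ∀ w : PlacesOver L v, Valued.v ((ϖ : LocalRing L v) w) = WithZero.exp (-1 : ℤ))
    (w₀ : ↥(unitaryGroupOfForm (conjLocal L (IsCMField.complexConj L) v) (cmLocalForm L 3 v))) (hw₀ : Units.val (w₀ : GL (Fin 3) (LocalRing L v)) = cmLocalForm L 3 v)
    (f : haveI := locallyCompactSpace_cmBorelU L 3 v
      Representation.SmoothInd (cmBorelTriple L 3 v).P (Representation.twist (((Representation.trivial ℂ ↥(torusU (conjLocal L (IsCMField.complexConj L) v) (cmLocalForm L 3 v)) ℂ).twist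
        (cmTorusCharPair L v χ₁ χ₂)).comp (cmBorelTriple L 3 v).proj) (rootDeltaChar (cmBorelTriple L 3 v).P)))
    (hf : haveI := locallyCompactSpace_cmBorelU L 3 v
      f ∈ (Representation.smoothIndRep (cmBorelTriple L 3 v).P _).fixedPoints (cmLocalIntegralLevel L 3 (Matrix.of fun i j : Fin 3 => if i.val + j.val + 1 = 3 then (1 : L) else 0) v))
    (u : ↥(cmBorelTriple L 3 v).N) (n : ℕ)
    (hu : (((∏ w' : PlacesOver L v, normAbs (w'.1.adicCompletion L) ((((((u : ↥(unitaryGroupOfForm (conjLocal L (IsCMField.complexConj L) v) (cmLocalForm L 3 v)))) : GL (Fin 3) (LocalRing L v)) : Matrix (Fin 3) (Fin 3) (LocalRing L v)) 0 2) w')) : ℝ≥0) : ℝ) =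
      (((unitModulusChar (LocalRing L v) ϖ : ℝ≥0) : ℝ)⁻¹) ^ (n + 1)) :
    f.toFun (w₀ * (u : ↥(unitaryGroupOfForm (conjLocal L (IsCMField.complexConj L) v) (cmLocalForm L 3 v)))) =
      (((χ₁ ϖ : ℂˣ) : ℂ) ^ (n + 1) * ((χ₂ ⟨-1, F0P3cStCharTSBigCellFactorisation.neg_one_mem_normOneUnits (conjLocal L (IsCMField.complexConj L) v)⟩ : ℂˣ) : ℂ) *
          (((unitModulusChar (LocalRing L v) ϖ : ℝ≥0) : ℝ) : ℂ) ^ (n + 1)) * f.toFun 1 := by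
  obtain ⟨w⟩ : Nonempty (PlacesOver L v) := inferInstance
  have hw := hns w
  have ha0 : 0 < ((unitModulusChar (LocalRing L v) ϖ : ℝ≥0) : ℝ) := NNReal.coe_pos.2 distribHaarChar_pos
  have ha1 : ((unitModulusChar (LocalRing L v) ϖ : ℝ≥0) : ℝ) < 1 := by exact_mod_cast unitModulusChar_uniformizer_lt_one L v hns ϖ hϖ
  have hq : 1 < ((unitModulusChar (LocalRing L v) ϖ : ℝ≥0) : ℝ)⁻¹ := (one_lt_inv_iff₀.2 ⟨ha0, ha1⟩)
  have hgt : 1 < (((∏ w' : PlacesOver L v, normAbs (w'.1.adicCompletion L) ((((((u : ↥(unitaryGroupOfForm (conjLocal L (IsCMField.complexConj L) v) (cmLocalForm L 3 v)))) : GL (Fin 3) (LocalRing L v)) : Matrix (Fin 3) (Fin 3) (LocalRing L v)) 0 2) w')) : ℝ≥0) : ℝ) := by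
    rw [hu]
    exact one_lt_pow₀ hq (Nat.succ_ne_zero n)
  have hb0 : (((((u : ↥(unitaryGroupOfForm (conjLocal L (IsCMField.complexConj L) v) (cmLocalForm L 3 v)))) : GL (Fin 3) (LocalRing L v)) : Matrix (Fin 3) (Fin 3) (LocalRing L v)) 0 2) ≠ 0 := by
    intro h0
    rw [(F0P3cStCharTSLocalRingNormDictionary.prod_normAbs_eq_zero_iff L v w hw _).2 h0, NNReal.coe_zero] at hgt
    exact absurd hgt (not_lt.2 zero_le_one)
  have hb : IsUnit (((((u : ↥(unitaryGroupOfForm (conjLocal L (IsCMField.complexConj L) v) (cmLocalForm L 3 v)))) : GL (Fin 3) (LocalRing L v)) : Matrix (Fin 3) (Fin 3) (LocalRing L v)) 0 2) :=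
    (F0P3cStCharTSLocalRingNormDictionary.isUnit_iff_ne_zero_localRing L v w hw _).2 hb0
  have hgt' : 1 < (∏ w' : PlacesOver L v, normAbs (w'.1.adicCompletion L) ((((((u : ↥(unitaryGroupOfForm (conjLocal L (IsCMField.complexConj L) v) (cmLocalForm L 3 v)))) : GL (Fin 3) (LocalRing L v)) : Matrix (Fin 3) (Fin 3) (LocalRing L v)) 0 2) w')) := by
    exact_mod_cast hgt
  rw [K2E3SphericalCellFunction.toFun_weylElt_mul_eq_of_one_lt_height L v w hw χ₁ χ₂ w₀ hw₀ f hf u hgt' hb, smul_eq_mul]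
  -- the exponent of `b = u₀₂` is `−(n+1)`
  obtain ⟨m, hvm, hm⟩ := exists_height_eq_zpow L v hns ϖ hϖ u hb
  have hmn : m = -((n + 1 : ℕ) : ℤ) := by
    refine zpow_right_injective₀ ha0 ha1.ne ?_
    change ((unitModulusChar (LocalRing L v) ϖ : ℝ≥0) : ℝ) ^ m = ((unitModulusChar (LocalRing L v) ϖ : ℝ≥0) : ℝ) ^ (-((n + 1 : ℕ) : ℤ))
    rw [zpow_neg, zpow_natCast, ← inv_pow, ← hu, ← NNReal.coe_zpow, ← hm]
  have hχ : χ₁ (Units.map (conjLocal L (IsCMField.complexConj L) v : LocalRing L v →* LocalRing L v) hb.unit) = χ₁ ϖ ^ m := by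
    rw [apply_unitsMap_conjLocal L v hns χ₁ hunr,
      apply_eq_apply_uniformizer_zpow L v χ₁ hunr ϖ hϖ hb.unit m (fun w' => by rw [hb.unit_spec]; exact hvm w')]
  have hmod : unitModulusChar (LocalRing L v) hb.unit = unitModulusChar (LocalRing L v) ϖ ^ m := by
    rw [← hm, unitModulusChar_localRing_eq_prod, hb.unit_spec]
  rw [hχ, hmod, hmn, zpow_neg, inv_inv, zpow_natCast, zpow_neg, inv_inv, zpow_natCast, Units.val_pow_eq_pow_val, NNReal.coe_pow, Complex.ofReal_pow]

/-! ## §4 The shell expansion of `∫_N f(w₀ u) dμ` -/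

set_option synthInstance.maxHeartbeats 400000 in
set_option maxHeartbeats 8000000 in
-- statement∕proof over the `SmoothInd` carrier of ★ `cmPrincipalSeries` + the shell partition of `N` (class of ★ `K2E3RankOneIntertwiningIntegralConvergence.integrable_cellFun`)
/-- **THE SHELL SERIES (`HasSum` form).**  `v` non-split, `χ₁` UNRAMIFIED, `ϖ` a uniformiser unit, `w₀` of matrix `Φ₃`, `f` a `K_v`-fixed vector of the carrier of ★ `cmPrincipalSeries L 3 v (χ₁, χ₂)`,
`μ` ANY measure on `N(L⁺_v)` for which `u ↦ f(w₀ u)` is integrable.  The shells `S_{n+1} = {m = (‖ϖ‖⁻¹)^{n+1}}` are measurable, pairwise disjoint, with union `{1 < m}` (§2), and on `S_{n+1}`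
the integrand is the constant of §3; so **`Σ_n μ(S_{n+1}) · (χ₁(ϖ)^{n+1} χ₂(−1) ‖ϖ‖^{n+1}) · f(1)` HAS SUM `∫_{1 < m} f(w₀ u) dμ`** (Mathlib `hasSum_integral_iUnion`, `setIntegral_const`).
[cite: Casselman1995, §6.4 p. 63] [cite: Rogawski1990, §4.5 p. 45] [cite: TateThesis1967, §2.4] -/
theorem hasSum_shell_integrals (hns : ∀ w : PlacesOver L v, IsCMField.complexConj L • w.1 = w.1)
    (χ₁ : (LocalRing L v)ˣ →* ℂˣ) (χ₂ : ↥(normOneUnits (conjLocal L (IsCMField.complexConj L) v)) →* ℂˣ)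
    (hunr : ∀ u ∈ (Submonoid.pi Set.univ (fun w : PlacesOver L v => (w.1.adicCompletionIntegers L).toSubring.toSubmonoid)).units, χ₁ u = 1)
    (ϖ : (LocalRing L v)ˣ) (hϖ : ∀ w : PlacesOver L v, Valued.v ((ϖ : LocalRing L v) w) = WithZero.exp (-1 : ℤ))
    (w₀ : ↥(unitaryGroupOfForm (conjLocal L (IsCMField.complexConj L) v) (cmLocalForm L 3 v))) (hw₀ : Units.val (w₀ : GL (Fin 3) (LocalRing L v)) = cmLocalForm L 3 v)
    [MeasurableSpace ↥(cmBorelTriple L 3 v).N] [BorelSpace ↥(cmBorelTriple L 3 v).N] (μ : Measure ↥(cmBorelTriple L 3 v).N)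
    (f : haveI := locallyCompactSpace_cmBorelU L 3 v
      Representation.SmoothInd (cmBorelTriple L 3 v).P (Representation.twist (((Representation.trivial ℂ ↥(torusU (conjLocal L (IsCMField.complexConj L) v) (cmLocalForm L 3 v)) ℂ).twist
        (cmTorusCharPair L v χ₁ χ₂)).comp (cmBorelTriple L 3 v).proj) (rootDeltaChar (cmBorelTriple L 3 v).P)))
    (hf : haveI := locallyCompactSpace_cmBorelU L 3 v
      f ∈ (Representation.smoothIndRep (cmBorelTriple L 3 v).P _).fixedPoints (cmLocalIntegralLevel L 3 (Matrix.of fun i j : Fin 3 => if i.val + j.val + 1 = 3 then (1 : L) else 0) v))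
    (hint : Integrable (fun u : ↥(cmBorelTriple L 3 v).N => f.toFun (w₀ * (u : ↥(unitaryGroupOfForm (conjLocal L (IsCMField.complexConj L) v) (cmLocalForm L 3 v))))) μ) :
    HasSum (fun n : ℕ => (μ.real {u : ↥(cmBorelTriple L 3 v).N | (((∏ w' : PlacesOver L v, normAbs (w'.1.adicCompletion L) ((((((u : ↥(unitaryGroupOfForm (conjLocal L (IsCMField.complexConj L) v) (cmLocalForm L 3 v)))) : GL (Fin 3) (LocalRing L v)) : Matrix (Fin 3) (Fin 3) (LocalRing L v)) 0 2) w')) : ℝ≥0) : ℝ) = (((unitModulusChar (LocalRing L v) ϖ : ℝ≥0) : ℝ)⁻¹) ^ (n + 1)} : ℂ) *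
        ((((χ₁ ϖ : ℂˣ) : ℂ) ^ (n + 1) * ((χ₂ ⟨-1, F0P3cStCharTSBigCellFactorisation.neg_one_mem_normOneUnits (conjLocal L (IsCMField.complexConj L) v)⟩ : ℂˣ) : ℂ) *
          (((unitModulusChar (LocalRing L v) ϖ : ℝ≥0) : ℝ) : ℂ) ^ (n + 1)) * f.toFun 1))
      (∫ u in {u : ↥(cmBorelTriple L 3 v).N | 1 < (((∏ w' : PlacesOver L v, normAbs (w'.1.adicCompletion L) ((((((u : ↥(unitaryGroupOfForm (conjLocal L (IsCMField.complexConj L) v) (cmLocalForm L 3 v)))) : GL (Fin 3) (LocalRing L v)) : Matrix (Fin 3) (Fin 3) (LocalRing L v)) 0 2) w')) : ℝ≥0) : ℝ)}, f.toFun (w₀ * (u : ↥(unitaryGroupOfForm (conjLocal L (IsCMField.complexConj L) v) (cmLocalForm L 3 v)))) ∂μ) := by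
  haveI := locallyCompactSpace_cmBorelU L 3 v
  have ha0 : 0 < ((unitModulusChar (LocalRing L v) ϖ : ℝ≥0) : ℝ) := NNReal.coe_pos.2 distribHaarChar_pos
  have ha1 : ((unitModulusChar (LocalRing L v) ϖ : ℝ≥0) : ℝ) < 1 := by exact_mod_cast unitModulusChar_uniformizer_lt_one L v hns ϖ hϖ
  have hq : 1 < (((unitModulusChar (LocalRing L v) ϖ : ℝ≥0) : ℝ)⁻¹) := (one_lt_inv_iff₀.2 ⟨ha0, ha1⟩)
  have hm : Measurable fun u : ↥(cmBorelTriple L 3 v).N => (((∏ w' : PlacesOver L v, normAbs (w'.1.adicCompletion L) ((((((u : ↥(unitaryGroupOfForm (conjLocal L (IsCMField.complexConj L) v) (cmLocalForm L 3 v)))) : GL (Fin 3) (LocalRing L v)) : Matrix (Fin 3) (Fin 3) (LocalRing L v)) 0 2) w')) : ℝ≥0) : ℝ) :=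
    (F0P3cStCharTSKeys3AnnulusDock.continuous_norm_entry L v).measurable
  set S : ℕ → Set ↥(cmBorelTriple L 3 v).N := fun n => {u | (((∏ w' : PlacesOver L v, normAbs (w'.1.adicCompletion L) ((((((u : ↥(unitaryGroupOfForm (conjLocal L (IsCMField.complexConj L) v) (cmLocalForm L 3 v)))) : GL (Fin 3) (LocalRing L v)) : Matrix (Fin 3) (Fin 3) (LocalRing L v)) 0 2) w')) : ℝ≥0) : ℝ) = (((unitModulusChar (LocalRing L v) ϖ : ℝ≥0) : ℝ)⁻¹) ^ (n + 1)} with hS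
  have hSm : ∀ n, MeasurableSet (S n) := fun n => measurableSet_eq_fun hm measurable_const
  have hdisjS : Pairwise (Function.onFun Disjoint S) := fun i j hij => Set.disjoint_left.2 fun u hi hj => hij <| by
    have h : (((unitModulusChar (LocalRing L v) ϖ : ℝ≥0) : ℝ)⁻¹) ^ (i + 1) = (((unitModulusChar (LocalRing L v) ϖ : ℝ≥0) : ℝ)⁻¹) ^ (j + 1) := hi.symm.trans hj
    exact Nat.succ_injective (pow_right_injective₀ (zero_lt_one.trans hq) hq.ne' h)
  have hU : (⋃ n, S n) = {u : ↥(cmBorelTriple L 3 v).N | 1 < (((∏ w' : PlacesOver L v, normAbs (w'.1.adicCompletion L) ((((((u : ↥(unitaryGroupOfForm (conjLocal L (IsCMField.complexConj L) v) (cmLocalForm L 3 v)))) : GL (Fin 3) (LocalRing L v)) : Matrix (Fin 3) (Fin 3) (LocalRing L v)) 0 2) w')) : ℝ≥0) : ℝ)} := by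
    refine Set.ext fun u => ⟨fun hu => ?_, fun hu => ?_⟩
    · obtain ⟨n, hn⟩ := Set.mem_iUnion.1 hu
      simp only [hS, Set.mem_setOf_eq] at hn ⊢
      rw [hn]
      exact one_lt_pow₀ hq (Nat.succ_ne_zero n)
    · rcases height_le_one_or_eq_inv_pow L v hns ϖ hϖ u with h | ⟨n, hn⟩
      · exact absurd hu (not_lt.2 h)
      · exact Set.mem_iUnion.2 ⟨n, hn⟩
  rw [← hU]
  have h := hasSum_integral_iUnion hSm hdisjS (hint.integrableOn (s := ⋃ n, S n))
  have hterm : (fun n : ℕ => ∫ u in S n, f.toFun (w₀ * (u : ↥(unitaryGroupOfForm (conjLocal L (IsCMField.complexConj L) v) (cmLocalForm L 3 v)))) ∂μ) =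
      fun n : ℕ => (μ.real (S n) : ℂ) * ((((χ₁ ϖ : ℂˣ) : ℂ) ^ (n + 1) * ((χ₂ ⟨-1, F0P3cStCharTSBigCellFactorisation.neg_one_mem_normOneUnits (conjLocal L (IsCMField.complexConj L) v)⟩ : ℂˣ) : ℂ) *
          (((unitModulusChar (LocalRing L v) ϖ : ℝ≥0) : ℝ) : ℂ) ^ (n + 1)) * f.toFun 1) := by
    funext n
    rw [setIntegral_congr_fun (hSm n) (fun u hu => toFun_weylElt_mul_eq_on_shell L v hns χ₁ χ₂ hunr ϖ hϖ w₀ hw₀ f hf u n hu), setIntegral_const, Complex.real_smul]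
  rw [hterm] at h
  exact h

set_option synthInstance.maxHeartbeats 400000 in
set_option maxHeartbeats 8000000 in
-- statement∕proof over the `SmoothInd` carrier of ★ `cmPrincipalSeries` + the shell partition of `N` (class of ★ `K2E3RankOneIntertwiningIntegralConvergence.integrable_cellFun`)
/-- **THE SHELL EXPANSION OF HARISH-CHANDRA'S `c`-FUNCTION INTEGRAL.**  `v` non-split, `χ₁` UNRAMIFIED, `ϖ` a uniformiser unit, `w₀` of matrix `Φ₃`, `f` a `K_v`-fixed vector of the
carrier of ★ `cmPrincipalSeries L 3 v (χ₁, χ₂)`, `μ` ANY measure on `N(L⁺_v)` for which the cell function `u ↦ f(w₀ u)` is integrable (★ `integrable_cellFun` for Haar `μ` and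
`|χ₁| = ‖·‖^s`, `s > 0`).  With `B₁ = {m ≤ 1}` and the shells `S_{n+1} = {m = (‖ϖ‖⁻¹)^{n+1}}`:
**`∫_N f(w₀ u) dμ = μ(B₁)·f(1) + Σ'_{n : ℕ} μ(S_{n+1}) · (χ₁(ϖ)^{n+1} χ₂(−1) ‖ϖ‖^{n+1}) · f(1)`** — `N = B₁ ⊔ {1 < m}`, `f(w₀ u) = f(1)` on `B₁` (★ `K2E3SphericalCellFunction` §3), and
`hasSum_shell_integrals` on `{1 < m}`; Mathlib `setIntegral_union`, `setIntegral_const`. [cite: Casselman1995, §6.4 p. 63] [cite: Rogawski1990, §4.5 p. 45] [cite: TateThesis1967, §2.4] -/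
theorem integral_cellFun_eq_shellExpansion (hns : ∀ w : PlacesOver L v, IsCMField.complexConj L • w.1 = w.1)
    (χ₁ : (LocalRing L v)ˣ →* ℂˣ) (χ₂ : ↥(normOneUnits (conjLocal L (IsCMField.complexConj L) v)) →* ℂˣ)
    (hunr : ∀ u ∈ (Submonoid.pi Set.univ (fun w : PlacesOver L v => (w.1.adicCompletionIntegers L).toSubring.toSubmonoid)).units, χ₁ u = 1)
    (ϖ : (LocalRing L v)ˣ) (hϖ : ∀ w : PlacesOver L v, Valued.v ((ϖ : LocalRing L v) w) = WithZero.exp (-1 : ℤ))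
    (w₀ : ↥(unitaryGroupOfForm (conjLocal L (IsCMField.complexConj L) v) (cmLocalForm L 3 v))) (hw₀ : Units.val (w₀ : GL (Fin 3) (LocalRing L v)) = cmLocalForm L 3 v)
    [MeasurableSpace ↥(cmBorelTriple L 3 v).N] [BorelSpace ↥(cmBorelTriple L 3 v).N] (μ : Measure ↥(cmBorelTriple L 3 v).N)
    (f : haveI := locallyCompactSpace_cmBorelU L 3 v
      Representation.SmoothInd (cmBorelTriple L 3 v).P (Representation.twist (((Representation.trivial ℂ ↥(torusU (conjLocal L (IsCMField.complexConj L) v) (cmLocalForm L 3 v)) ℂ).twist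
        (cmTorusCharPair L v χ₁ χ₂)).comp (cmBorelTriple L 3 v).proj) (rootDeltaChar (cmBorelTriple L 3 v).P)))
    (hf : haveI := locallyCompactSpace_cmBorelU L 3 v
      f ∈ (Representation.smoothIndRep (cmBorelTriple L 3 v).P _).fixedPoints (cmLocalIntegralLevel L 3 (Matrix.of fun i j : Fin 3 => if i.val + j.val + 1 = 3 then (1 : L) else 0) v))
    (hint : Integrable (fun u : ↥(cmBorelTriple L 3 v).N => f.toFun (w₀ * (u : ↥(unitaryGroupOfForm (conjLocal L (IsCMField.complexConj L) v) (cmLocalForm L 3 v))))) μ) :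
    ∫ u : ↥(cmBorelTriple L 3 v).N, f.toFun (w₀ * (u : ↥(unitaryGroupOfForm (conjLocal L (IsCMField.complexConj L) v) (cmLocalForm L 3 v)))) ∂μ =
      (μ.real {u : ↥(cmBorelTriple L 3 v).N | (((∏ w' : PlacesOver L v, normAbs (w'.1.adicCompletion L) ((((((u : ↥(unitaryGroupOfForm (conjLocal L (IsCMField.complexConj L) v) (cmLocalForm L 3 v)))) : GL (Fin 3) (LocalRing L v)) : Matrix (Fin 3) (Fin 3) (LocalRing L v)) 0 2) w')) : ℝ≥0) : ℝ) ≤ 1} : ℂ) * f.toFun 1 +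
      ∑' n : ℕ, (μ.real {u : ↥(cmBorelTriple L 3 v).N | (((∏ w' : PlacesOver L v, normAbs (w'.1.adicCompletion L) ((((((u : ↥(unitaryGroupOfForm (conjLocal L (IsCMField.complexConj L) v) (cmLocalForm L 3 v)))) : GL (Fin 3) (LocalRing L v)) : Matrix (Fin 3) (Fin 3) (LocalRing L v)) 0 2) w')) : ℝ≥0) : ℝ) = (((unitModulusChar (LocalRing L v) ϖ : ℝ≥0) : ℝ)⁻¹) ^ (n + 1)} : ℂ) *
        ((((χ₁ ϖ : ℂˣ) : ℂ) ^ (n + 1) * ((χ₂ ⟨-1, F0P3cStCharTSBigCellFactorisation.neg_one_mem_normOneUnits (conjLocal L (IsCMField.complexConj L) v)⟩ : ℂˣ) : ℂ) *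
          (((unitModulusChar (LocalRing L v) ϖ : ℝ≥0) : ℝ) : ℂ) ^ (n + 1)) * f.toFun 1) := by
  haveI := locallyCompactSpace_cmBorelU L 3 v
  obtain ⟨w⟩ : Nonempty (PlacesOver L v) := inferInstance
  have hm : Measurable fun u : ↥(cmBorelTriple L 3 v).N => (((∏ w' : PlacesOver L v, normAbs (w'.1.adicCompletion L) ((((((u : ↥(unitaryGroupOfForm (conjLocal L (IsCMField.complexConj L) v) (cmLocalForm L 3 v)))) : GL (Fin 3) (LocalRing L v)) : Matrix (Fin 3) (Fin 3) (LocalRing L v)) 0 2) w')) : ℝ≥0) : ℝ) :=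
    (F0P3cStCharTSKeys3AnnulusDock.continuous_norm_entry L v).measurable
  have hBm : MeasurableSet {u : ↥(cmBorelTriple L 3 v).N | (((∏ w' : PlacesOver L v, normAbs (w'.1.adicCompletion L) ((((((u : ↥(unitaryGroupOfForm (conjLocal L (IsCMField.complexConj L) v) (cmLocalForm L 3 v)))) : GL (Fin 3) (LocalRing L v)) : Matrix (Fin 3) (Fin 3) (LocalRing L v)) 0 2) w')) : ℝ≥0) : ℝ) ≤ 1} := measurableSet_le hm measurable_const
  have hTm : MeasurableSet {u : ↥(cmBorelTriple L 3 v).N | 1 < (((∏ w' : PlacesOver L v, normAbs (w'.1.adicCompletion L) ((((((u : ↥(unitaryGroupOfForm (conjLocal L (IsCMField.complexConj L) v) (cmLocalForm L 3 v)))) : GL (Fin 3) (LocalRing L v)) : Matrix (Fin 3) (Fin 3) (LocalRing L v)) 0 2) w')) : ℝ≥0) : ℝ)} := measurableSet_lt measurable_const hm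
  have hdisj : Disjoint {u : ↥(cmBorelTriple L 3 v).N | (((∏ w' : PlacesOver L v, normAbs (w'.1.adicCompletion L) ((((((u : ↥(unitaryGroupOfForm (conjLocal L (IsCMField.complexConj L) v) (cmLocalForm L 3 v)))) : GL (Fin 3) (LocalRing L v)) : Matrix (Fin 3) (Fin 3) (LocalRing L v)) 0 2) w')) : ℝ≥0) : ℝ) ≤ 1} {u : ↥(cmBorelTriple L 3 v).N | 1 < (((∏ w' : PlacesOver L v, normAbs (w'.1.adicCompletion L) ((((((u : ↥(unitaryGroupOfForm (conjLocal L (IsCMField.complexConj L) v) (cmLocalForm L 3 v)))) : GL (Fin 3) (LocalRing L v)) : Matrix (Fin 3) (Fin 3) (LocalRing L v)) 0 2) w')) : ℝ≥0) : ℝ)} :=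
    Set.disjoint_left.2 fun u hu hu' => by rw [Set.mem_setOf_eq] at hu hu'; exact not_lt.2 hu hu'
  have hcover : {u : ↥(cmBorelTriple L 3 v).N | (((∏ w' : PlacesOver L v, normAbs (w'.1.adicCompletion L) ((((((u : ↥(unitaryGroupOfForm (conjLocal L (IsCMField.complexConj L) v) (cmLocalForm L 3 v)))) : GL (Fin 3) (LocalRing L v)) : Matrix (Fin 3) (Fin 3) (LocalRing L v)) 0 2) w')) : ℝ≥0) : ℝ) ≤ 1} ∪ {u : ↥(cmBorelTriple L 3 v).N | 1 < (((∏ w' : PlacesOver L v, normAbs (w'.1.adicCompletion L) ((((((u : ↥(unitaryGroupOfForm (conjLocal L (IsCMField.complexConj L) v) (cmLocalForm L 3 v)))) : GL (Fin 3) (LocalRing L v)) : Matrix (Fin 3) (Fin 3) (LocalRing L v)) 0 2) w')) : ℝ≥0) : ℝ)} = Set.univ :=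
    Set.eq_univ_of_forall fun u => by rw [Set.mem_union, Set.mem_setOf_eq, Set.mem_setOf_eq]; exact le_or_gt _ _
  rw [← setIntegral_univ, ← hcover, setIntegral_union hdisj hTm hint.integrableOn hint.integrableOn,
    ← (hasSum_shell_integrals L v hns χ₁ χ₂ hunr ϖ hϖ w₀ hw₀ μ f hf hint).tsum_eq]
  congr 1
  rw [setIntegral_congr_fun hBm (fun u hu =>
      K2E3SphericalCellFunction.toFun_weylElt_mul_eq_toFun_one_of_height_le_one L v w (hns w) (cmTorusCharPair L v χ₁ χ₂) w₀ hw₀ f hf u (by exact_mod_cast hu)),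
    setIntegral_const, Complex.real_smul]

set_option synthInstance.maxHeartbeats 400000 in
set_option maxHeartbeats 8000000 in
-- statement∕proof over the `SmoothInd` carrier of ★ `cmPrincipalSeries` (class of ★ `K2E3RankOneIntertwiningIntegralConvergence.integrable_cellFun`)
/-- **THE SHELL EXPANSION, INTEGRABILITY DISCHARGED**: `v` non-split, `χ₂` continuous, `χ₁` UNRAMIFIED with `|χ₁(x)| = ‖x‖^s` for all `x` and `s > 0` (the convergent cone of road I),
`μ` a Haar measure of `N(L⁺_v)`, `f` `K_v`-fixed; then `u ↦ f(w₀ u)` is integrable (★ `integrable_cellFun`) and `integral_cellFun_eq_shellExpansion` applies verbatim: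
`∫_N f(w₀ u) dμ = μ(B₁)·f(1) + Σ'_n μ(S_{n+1}) · (χ₁(ϖ)^{n+1} χ₂(−1) ‖ϖ‖^{n+1}) · f(1)`. [cite: Casselman1995, §6.4 pp. 62–64] [cite: Rogawski1990, §4.5 p. 45] [cite: Keys1984, §4] -/
theorem integral_cellFun_eq_shellExpansion_of_modulus (hns : ∀ w : PlacesOver L v, IsCMField.complexConj L • w.1 = w.1)
    (χ₁ : (LocalRing L v)ˣ →* ℂˣ) (χ₂ : ↥(normOneUnits (conjLocal L (IsCMField.complexConj L) v)) →* ℂˣ)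
    (h₂ : Continuous fun x => ((χ₂ x : ℂˣ) : ℂ))
    (hunr : ∀ u ∈ (Submonoid.pi Set.univ (fun w : PlacesOver L v => (w.1.adicCompletionIntegers L).toSubring.toSubmonoid)).units, χ₁ u = 1) {s : ℝ} (hs : 0 < s)
    (hχ₁ : ∀ x : (LocalRing L v)ˣ, ‖((χ₁ x : ℂˣ) : ℂ)‖ = ((unitModulusChar (LocalRing L v) x : ℝ≥0) : ℝ) ^ s)
    (ϖ : (LocalRing L v)ˣ) (hϖ : ∀ w : PlacesOver L v, Valued.v ((ϖ : LocalRing L v) w) = WithZero.exp (-1 : ℤ))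
    (w₀ : ↥(unitaryGroupOfForm (conjLocal L (IsCMField.complexConj L) v) (cmLocalForm L 3 v))) (hw₀ : Units.val (w₀ : GL (Fin 3) (LocalRing L v)) = cmLocalForm L 3 v)
    [MeasurableSpace ↥(cmBorelTriple L 3 v).N] [BorelSpace ↥(cmBorelTriple L 3 v).N] (μ : Measure ↥(cmBorelTriple L 3 v).N) [μ.IsHaarMeasure]
    (f : haveI := locallyCompactSpace_cmBorelU L 3 v
      Representation.SmoothInd (cmBorelTriple L 3 v).P (Representation.twist (((Representation.trivial ℂ ↥(torusU (conjLocal L (IsCMField.complexConj L) v) (cmLocalForm L 3 v)) ℂ).twist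
        (cmTorusCharPair L v χ₁ χ₂)).comp (cmBorelTriple L 3 v).proj) (rootDeltaChar (cmBorelTriple L 3 v).P)))
    (hf : haveI := locallyCompactSpace_cmBorelU L 3 v
      f ∈ (Representation.smoothIndRep (cmBorelTriple L 3 v).P _).fixedPoints (cmLocalIntegralLevel L 3 (Matrix.of fun i j : Fin 3 => if i.val + j.val + 1 = 3 then (1 : L) else 0) v)) :
    ∫ u : ↥(cmBorelTriple L 3 v).N, f.toFun (w₀ * (u : ↥(unitaryGroupOfForm (conjLocal L (IsCMField.complexConj L) v) (cmLocalForm L 3 v)))) ∂μ =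
      (μ.real {u : ↥(cmBorelTriple L 3 v).N | (((∏ w' : PlacesOver L v, normAbs (w'.1.adicCompletion L) ((((((u : ↥(unitaryGroupOfForm (conjLocal L (IsCMField.complexConj L) v) (cmLocalForm L 3 v)))) : GL (Fin 3) (LocalRing L v)) : Matrix (Fin 3) (Fin 3) (LocalRing L v)) 0 2) w')) : ℝ≥0) : ℝ) ≤ 1} : ℂ) * f.toFun 1 +
      ∑' n : ℕ, (μ.real {u : ↥(cmBorelTriple L 3 v).N | (((∏ w' : PlacesOver L v, normAbs (w'.1.adicCompletion L) ((((((u : ↥(unitaryGroupOfForm (conjLocal L (IsCMField.complexConj L) v) (cmLocalForm L 3 v)))) : GL (Fin 3) (LocalRing L v)) : Matrix (Fin 3) (Fin 3) (LocalRing L v)) 0 2) w')) : ℝ≥0) : ℝ) = (((unitModulusChar (LocalRing L v) ϖ : ℝ≥0) : ℝ)⁻¹) ^ (n + 1)} : ℂ) *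
        ((((χ₁ ϖ : ℂˣ) : ℂ) ^ (n + 1) * ((χ₂ ⟨-1, F0P3cStCharTSBigCellFactorisation.neg_one_mem_normOneUnits (conjLocal L (IsCMField.complexConj L) v)⟩ : ℂˣ) : ℂ) *
          (((unitModulusChar (LocalRing L v) ϖ : ℝ≥0) : ℝ) : ℂ) ^ (n + 1)) * f.toFun 1) :=
  integral_cellFun_eq_shellExpansion L v hns χ₁ χ₂ hunr ϖ hϖ w₀ hw₀ μ f hf
    (K2E3RankOneIntertwiningIntegralConvergence.integrable_cellFun L v hns χ₁ χ₂ h₂ hs hχ₁ w₀ hw₀ μ f)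

/-! ## §5 Harish-Chandra's `c`-function as a shell series: `J(w, χ) f_K = (μ(B₁) f_K(1) + Σ_k μ(S_k) (χ₁(ϖ)‖ϖ‖)ᵏ χ₂(−1) f_K(1)) • f'_K` -/

set_option synthInstance.maxHeartbeats 400000 in
set_option maxHeartbeats 8000000 in
-- statement∕proof over two `SmoothInd` carriers of ★ `cmPrincipalSeries` (class of ★ `K2E3IntertwiningIntegralSphericalLine.exists_intertwiningIntegral_sphericalVector_eq_smul`)
/-- **HARISH-CHANDRA'S `c`-FUNCTION AS A SHELL SERIES** (docked on ★ I-2a).  `v` NON-SPLIT, `w₀` of matrix `Φ₃`, `μ` a Haar measure of `N(L⁺_v)`, `ϖ` a uniformiser unit, `χ₁, χ₂` continuous,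
`χ₁` UNRAMIFIED with `|χ₁| = ‖·‖^s`, `s > 0`; `f_K ∈ i_G(χ)^{K_v}`, `f'_K ∈ i_G(wχ)^{K_v}` with `f'_K(1) = 1`.  Then the intertwining integral `J` of ★ RUNG 3 (`J ≠ 0`,
`(J f)(g) = ∫_N f(w₀ n g) dμ`) satisfies **`J f_K = (μ(B₁)·f_K(1) + Σ'_n μ(S_{n+1}) · (χ₁(ϖ)^{n+1} χ₂(−1) ‖ϖ‖^{n+1}) · f_K(1)) • f'_K`** — ★ I-2a gives `J f_K = (∫_N f_K(w₀ n) dμ) • f'_K` and §4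
expands the integral.  With `f_K(1) = 1`, `χ₂ = 1` (forced by unramifiedness of `χ` on `E¹ ⊆ K_v`), `q = ‖ϖ‖⁻¹`, `z = χ₁(ϖ)`: `c_w(χ) = μ(B₁) + Σ_{k≥1} (z∕q)^k μ(S_k)`
([Casselman1995, §6.4]: «`T_w φ_K = c_w(χ) φ_{K,wχ}`»; the closed form via the `q²`-periodicity ★ `K2E3HeightBallVolumeScaling` is the next brick).
[cite: Casselman1995, §6.4 pp. 62–64] [cite: Rogawski1990, §4.5 p. 45; §12.2 p. 173] [cite: Keys1984, §3–§4] -/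
theorem exists_intertwiningIntegral_sphericalVector_eq_shellExpansion_smul (hns : ∀ w : PlacesOver L v, IsCMField.complexConj L • w.1 = w.1)
    (χ₁ : (LocalRing L v)ˣ →* ℂˣ) (χ₂ : ↥(normOneUnits (conjLocal L (IsCMField.complexConj L) v)) →* ℂˣ)
    (h₁ : Continuous fun x => ((χ₁ x : ℂˣ) : ℂ)) (h₂ : Continuous fun x => ((χ₂ x : ℂˣ) : ℂ))
    (hunr : ∀ u ∈ (Submonoid.pi Set.univ (fun w : PlacesOver L v => (w.1.adicCompletionIntegers L).toSubring.toSubmonoid)).units, χ₁ u = 1) {s : ℝ} (hs : 0 < s)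
    (hχ₁ : ∀ x : (LocalRing L v)ˣ, ‖((χ₁ x : ℂˣ) : ℂ)‖ = ((unitModulusChar (LocalRing L v) x : ℝ≥0) : ℝ) ^ s)
    (ϖ : (LocalRing L v)ˣ) (hϖ : ∀ w : PlacesOver L v, Valued.v ((ϖ : LocalRing L v) w) = WithZero.exp (-1 : ℤ))
    (w₀ : ↥(unitaryGroupOfForm (conjLocal L (IsCMField.complexConj L) v) (cmLocalForm L 3 v))) (hw₀ : Units.val (w₀ : GL (Fin 3) (LocalRing L v)) = cmLocalForm L 3 v)
    [MeasurableSpace ↥(cmBorelTriple L 3 v).N] [BorelSpace ↥(cmBorelTriple L 3 v).N] (μ : Measure ↥(cmBorelTriple L 3 v).N) [μ.IsHaarMeasure]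
    (fK : haveI := locallyCompactSpace_cmBorelU L 3 v
      Representation.SmoothInd (cmBorelTriple L 3 v).P (Representation.twist (((Representation.trivial ℂ ↥(torusU (conjLocal L (IsCMField.complexConj L) v) (cmLocalForm L 3 v)) ℂ).twist
        (cmTorusCharPair L v χ₁ χ₂)).comp (cmBorelTriple L 3 v).proj) (rootDeltaChar (cmBorelTriple L 3 v).P)))
    (hfK : haveI := locallyCompactSpace_cmBorelU L 3 v
      fK ∈ (Representation.smoothIndRep (cmBorelTriple L 3 v).P _).fixedPoints (cmLocalIntegralLevel L 3 (Matrix.of fun i j : Fin 3 => if i.val + j.val + 1 = 3 then (1 : L) else 0) v))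
    (fK' : haveI := locallyCompactSpace_cmBorelU L 3 v
      Representation.SmoothInd (cmBorelTriple L 3 v).P (Representation.twist (((Representation.trivial ℂ ↥(torusU (conjLocal L (IsCMField.complexConj L) v) (cmLocalForm L 3 v)) ℂ).twist
        (cmTorusCharPair L v (conjInvChar (conjLocal L (IsCMField.complexConj L) v) χ₁) χ₂)).comp (cmBorelTriple L 3 v).proj) (rootDeltaChar (cmBorelTriple L 3 v).P)))
    (hfK' : haveI := locallyCompactSpace_cmBorelU L 3 v
      fK' ∈ (Representation.smoothIndRep (cmBorelTriple L 3 v).P _).fixedPoints (cmLocalIntegralLevel L 3 (Matrix.of fun i j : Fin 3 => if i.val + j.val + 1 = 3 then (1 : L) else 0) v))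
    (h1 : fK'.toFun 1 = 1) :
    ∃ J : (cmPrincipalSeries L 3 v (cmTorusCharPair L v χ₁ χ₂)).IntertwiningMap (cmPrincipalSeries L 3 v (cmTorusCharPair L v (conjInvChar (conjLocal L (IsCMField.complexConj L) v) χ₁) χ₂)),
      J ≠ 0 ∧
      (∀ (f : haveI := locallyCompactSpace_cmBorelU L 3 v
      Representation.SmoothInd (cmBorelTriple L 3 v).P (Representation.twist (((Representation.trivial ℂ ↥(torusU (conjLocal L (IsCMField.complexConj L) v) (cmLocalForm L 3 v)) ℂ).twist
        (cmTorusCharPair L v χ₁ χ₂)).comp (cmBorelTriple L 3 v).proj) (rootDeltaChar (cmBorelTriple L 3 v).P)))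
        (g : ↥(unitaryGroupOfForm (conjLocal L (IsCMField.complexConj L) v) (cmLocalForm L 3 v))),
        (J f).toFun g = ∫ n : ↥(cmBorelTriple L 3 v).N, f.toFun (w₀ * (n : ↥(unitaryGroupOfForm (conjLocal L (IsCMField.complexConj L) v) (cmLocalForm L 3 v))) * g) ∂μ) ∧
      J fK = ((μ.real {u : ↥(cmBorelTriple L 3 v).N | (((∏ w' : PlacesOver L v, normAbs (w'.1.adicCompletion L) ((((((u : ↥(unitaryGroupOfForm (conjLocal L (IsCMField.complexConj L) v) (cmLocalForm L 3 v)))) : GL (Fin 3) (LocalRing L v)) : Matrix (Fin 3) (Fin 3) (LocalRing L v)) 0 2) w')) : ℝ≥0) : ℝ) ≤ 1} : ℂ) * fK.toFun 1 +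
        ∑' n : ℕ, (μ.real {u : ↥(cmBorelTriple L 3 v).N | (((∏ w' : PlacesOver L v, normAbs (w'.1.adicCompletion L) ((((((u : ↥(unitaryGroupOfForm (conjLocal L (IsCMField.complexConj L) v) (cmLocalForm L 3 v)))) : GL (Fin 3) (LocalRing L v)) : Matrix (Fin 3) (Fin 3) (LocalRing L v)) 0 2) w')) : ℝ≥0) : ℝ) = (((unitModulusChar (LocalRing L v) ϖ : ℝ≥0) : ℝ)⁻¹) ^ (n + 1)} : ℂ) *
          ((((χ₁ ϖ : ℂˣ) : ℂ) ^ (n + 1) * ((χ₂ ⟨-1, F0P3cStCharTSBigCellFactorisation.neg_one_mem_normOneUnits (conjLocal L (IsCMField.complexConj L) v)⟩ : ℂˣ) : ℂ) *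
          (((unitModulusChar (LocalRing L v) ϖ : ℝ≥0) : ℝ) : ℂ) ^ (n + 1)) * fK.toFun 1)) • fK' := by
  obtain ⟨J, hJ, hJint, hJK⟩ := K2E3IntertwiningIntegralSphericalLine.exists_intertwiningIntegral_sphericalVector_eq_smul L v hns χ₁ χ₂ h₁ h₂ hs hχ₁ w₀ hw₀ μ
    fK hfK fK' hfK' h1
  refine ⟨J, hJ, hJint, ?_⟩
  rw [hJK, integral_cellFun_eq_shellExpansion_of_modulus L v hns χ₁ χ₂ h₂ hunr hs hχ₁ ϖ hϖ w₀ hw₀ μ fK hfK]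

end Summit.HodgeConjecture.HodgeConjecture.Cruxes.H413.K2E3SphericalCFunctionShellExpansion

end
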